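import Mathlib
import Summits.KontsevichZagierPeriods.KontsevichZagierPeriods.Theorems.SoloInformedSubobjectLifting

/-!
  Soloist (informed) on the Kontsevich–Zagier period conjecture — session s26, kernel part 2 of Proposition VI-quater.

  Companion to `SoloInformedSubobjectLifting.lean`.  There, for a faithful functor `ι : C ⥤ D` preserving binary
  biproducts and reflecting isomorphisms, `ι.Full ∧ (weak subobject closure) ↔ SoloInformedSubobjectLifting ι`
  (the graph argument).  Here we record the abstract shape of step (b3) of Proposition VI-quater:

    FULLNESS + "every subobject of `ι.obj A` is a direct summand"  ⟹  subobject lifting AT `A`.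

  For `ι = (MM^eff_Nori ⊂ MM_Nori)` and `A` a PURE effective Nori motive, `ι.obj A` lies in the semisimple category of pure
  Nori motives, so every mono into it splits; the theorem below then says that every `MM`-subobject of a pure effective
  motive is an effective subobject, granted fullness.  (The passage from pure to all effective objects is a weight
  induction carried out on paper.)  We also record the one-line shape of (c4): fullness of a composite realisation
  `ι ⋙ R` with `R` faithful forces fullness of `ι`.

  Everything is abstract category theory over Mathlib; no motives are formalised.
-/

open CategoryTheory CategoryTheory.Limits

namespace Summit.KontsevichZagierPeriods.KontsevichZagierPeriods.Theorems

universe v₁ v₂ v₃ u₁ u₂ u₃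

variable {C : Type u₁} [Category.{v₁} C] {D : Type u₂} [Category.{v₂} D]

/-- Subobject lifting AT one object `A`: every subobject of `ι.obj A` is (isomorphic, over `ι.obj A`, to) the image
under `ι` of a subobject of `A`. `SoloInformedSubobjectLifting ι` is this for every `A`. -/
def SoloInformedSubobjectLiftingAt (ι : C ⥤ D) (A : C) : Prop :=
  ∀ ⦃S : D⦄ (m : S ⟶ ι.obj A), Mono m →
    ∃ (A' : C) (j : A' ⟶ A) (e : ι.obj A' ≅ S), Mono j ∧ e.hom ≫ m = ι.map j

/-- The global lifting property is the pointwise one at every object. -/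
theorem soloInformed_subobjectLifting_iff_forall (ι : C ⥤ D) :
    SoloInformedSubobjectLifting ι ↔ ∀ A : C, SoloInformedSubobjectLiftingAt ι A :=
  ⟨fun h _ _ m hm => h m hm, fun h _ _ m hm => h _ m hm⟩

/-- Elementary: if `m ≫ r = 𝟙` and `l ≫ m = k` then `l = k ≫ r`.  (Isolated so that it applies up to
definitional unfolding of cone points.) -/
theorem soloInformed_retraction_uniq {S X W : D} (m : S ⟶ X) (r : X ⟶ S) (hr : m ≫ r = 𝟙 S)
    (l : W ⟶ S) (k : W ⟶ X) (hl : l ≫ m = k) : l = k ≫ r := by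
  rw [← hl, Category.assoc, hr, Category.comp_id]

/-- **Step (b3) of Proposition VI-quater, abstract form.**  Let `ι : C ⥤ D` be full and faithful, let `C` have
equalizers and `ι` preserve them.  If every mono into `ι.obj A` is split (e.g. `ι.obj A` lies in a semisimple abelian
subcategory of `D` closed under subobjects), then every subobject of `ι.obj A` lifts to a subobject of `A`.
Proof: the idempotent `r ≫ m` (`r` a retraction of `m`) is `ι.map q` for an endomorphism `q` of `A`; the equalizer of
`q` and `𝟙 A` is the required subobject, because `ι` carries it to the equalizer of `ι.map q` and `𝟙`, which is `S`. -/
theorem soloInformed_subobjectLiftingAt_of_full_of_splitMono (ι : C ⥤ D) [ι.Full] [ι.Faithful]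
    [HasEqualizers C] [PreservesLimitsOfShape WalkingParallelPair ι] (A : C)
    (h : ∀ ⦃S : D⦄ (m : S ⟶ ι.obj A), Mono m → IsSplitMono m) :
    SoloInformedSubobjectLiftingAt ι A := by
  intro S m hm
  obtain ⟨r, hr⟩ : ∃ r : ι.obj A ⟶ S, m ≫ r = 𝟙 S := by
    obtain ⟨⟨sm⟩⟩ := h m hm
    exact ⟨sm.retraction, sm.id⟩
  -- the idempotent on `ι.obj A` with image `S`, and its preimage in `C`
  set q : A ⟶ A := ι.preimage (r ≫ m) with hq
  have hιq : ι.map q = r ≫ m := by simp [hq]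
  -- the candidate subobject of `A`
  let j : equalizer q (𝟙 A) ⟶ A := equalizer.ι q (𝟙 A)
  have w : j ≫ q = j ≫ 𝟙 A := equalizer.condition q (𝟙 A)
  -- `ι` preserves this equalizer
  have hl : IsLimit (Fork.ofι (ι.map j) (by simp only [← ι.map_comp, w]) :
      Fork (ι.map q) (ι.map (𝟙 A))) :=
    isLimitForkMapOfIsLimit ι w (equalizerIsEqualizer q (𝟙 A))
  -- `S`, via `m`, is also a limit of the same parallel pair (split idempotent)
  have wm : m ≫ ι.map q = m ≫ ι.map (𝟙 A) := by
    calc m ≫ ι.map q = m ≫ (r ≫ m) := congrArg _ hιq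
      _ = (m ≫ r) ≫ m := (Category.assoc _ _ _).symm
      _ = m := by rw [hr, Category.id_comp]
      _ = m ≫ 𝟙 _ := (Category.comp_id _).symm
      _ = m ≫ ι.map (𝟙 A) := congrArg _ (ι.map_id A).symm
  have hS : IsLimit (Fork.ofι m wm) := by
    refine Fork.IsLimit.mk _ (fun s => s.ι ≫ r) (fun s => ?_) (fun s l hl' => ?_)
    · rw [Fork.ι_ofι, Category.assoc]
      calc s.ι ≫ (r ≫ m) = s.ι ≫ ι.map q := congrArg _ hιq.symm
        _ = s.ι ≫ ι.map (𝟙 A) := s.condition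
        _ = s.ι ≫ 𝟙 _ := congrArg _ (ι.map_id A)
        _ = s.ι := Category.comp_id _
    · have hl'' : l ≫ m = s.ι := by rw [Fork.ι_ofι] at hl'; exact hl'
      exact soloInformed_retraction_uniq m r hr l s.ι hl''
  refine ⟨equalizer q (𝟙 A), j, IsLimit.conePointUniqueUpToIso hl hS, inferInstance, ?_⟩
  have h0 := IsLimit.conePointUniqueUpToIso_hom_comp hl hS WalkingParallelPair.zero
  rw [Fork.app_zero_eq_ι, Fork.app_zero_eq_ι, Fork.ι_ofι, Fork.ι_ofι] at h0
  exact h0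

/-- Global version: if `ι` is full and faithful, `C` has equalizers preserved by `ι`, and every mono into every
`ι.obj A` splits, then `ι` has subobject lifting (hence, by `soloInformed_weak_of_subobjectLifting`, its essential
image on subobjects is closed). -/
theorem soloInformed_subobjectLifting_of_full_of_splitMono (ι : C ⥤ D) [ι.Full] [ι.Faithful]
    [HasEqualizers C] [PreservesLimitsOfShape WalkingParallelPair ι]
    (h : ∀ (A : C) ⦃S : D⦄ (m : S ⟶ ι.obj A), Mono m → IsSplitMono m) :
    SoloInformedSubobjectLifting ι :=
  (soloInformed_subobjectLifting_iff_forall ι).2 fun A =>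
    soloInformed_subobjectLiftingAt_of_full_of_splitMono ι A (h A)

/-- **Shape of (c4) of Proposition VI-quater.**  If a realisation `R` of `D` is faithful and the composite
realisation `ι ⋙ R` of `C` is full, then `ι` is full: fullness of the Hodge realisation on EFFECTIVE Nori motives
would force fullness of `MM^eff_Nori ⊂ MM_Nori`.  (Mathlib's `Functor.Full.of_comp_faithful`.) -/
theorem soloInformed_full_of_comp_full {E : Type u₃} [Category.{v₃} E] (ι : C ⥤ D) (R : D ⥤ E)
    [R.Faithful] [(ι ⋙ R).Full] : ι.Full :=
  Functor.Full.of_comp_faithful ι R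

end Summit.KontsevichZagierPeriods.KontsevichZagierPeriods.Theorems
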